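import Mathlib
import Summits.Ventures.HodgeRepro.Tier4.Target
import Summits.Ventures.HodgeRepro.Tier4.Common.TargetData
import Summits.Ventures.HodgeRepro.Tier4.Common.AutForms
import Summits.Ventures.HodgeRepro.Tier4.Common.CornerForms
import Summits.Ventures.HodgeRepro.Tier4.Common.HeckeOnForms
import Summits.Ventures.HodgeRepro.Tier4.Common.TargetCalculus
import Summits.Ventures.HodgeRepro.Tier4.Line4.MixedTransfer
import Summits.Ventures.HodgeRepro.Tier4.Line4.Forms11
import Summits.Ventures.HodgeRepro.Tier4.Line4.HoloRegularity

/-!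
# Tier4/Line4/MixedClosed — L4.2 `mixed_closed` and L4.2′ `mixed_smooth`: the mixed `(1,1)`-forms of LINE L4 are closed and `C²` on the ball

Blind re-derivation cell `pub-hodge-repro`, Tier 4 «prove the step» (README §9–§10), seat t4-L4-p2 (prover, LINE L4,
gen 0).  Tree path `lean/Summits/Ventures/HodgeRepro/Tier4/Line4/MixedClosed.lean`.  Imports, BY NAME: the FROZEN
target (`Tier4/Target.lean`, «T4 TARGET FROZEN 7e1ddb58699909ce… 263», S11958), typer-1's `Common/TargetData`
(`TargetData`, `IsLevel`, `IsHeckeFor`), `Common/AutForms` (`isOpen_ball`), `Common/CornerForms` (`coord`,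
`differentiableOn_coord`), `Common/HeckeOnForms` (`differentiableAt_heckeTranslate`, `isUnitaryOf_of_mem_reps`),
typer-2's `Common/TargetCalculus` (`comp_heckeTranslate`), plan-4's `Line4/MixedTransfer` (p661007: `Form11`,
`mixedForm`, `grad`, `u₁ … u₄`, `ξ₁₃`, `ξ₂₄`) and `Line4/Forms11` (p661933: the DEFINED vocabulary `dz`, `dzbar`,
`IsClosed11`, `Smooth11`), and this seat's `Line4/HoloRegularity` (p662302: the several-variable regularity of
holomorphic functions — `HoloReg.differentiableAt_pd`, `HoloReg.pd_pd_symm`, `HoloReg.contDiffOn_real_of_differentiableOn`).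

THE LEMMAS (LINE L4 skeleton, t4-plan-4: L4.2 `mixed_closed` v0.2 3a41b9019878f878 L320–328 = v0.3 L213 = v0.4
55f0306b6d9d5c19 L137, L4.2′ `mixed_smooth` v0.3 L343 = v0.4 L250, statements VERBATIM; assigned to this seat by the lead,
S12095 / S12159): for every datum `d`, every level `Γ′` and every Hecke family `h` of level `Γ′`, the two mixed forms
`ξ₁₃(h) = du₁ ∧ conj du₃` and `ξ₂₄(h) = du₂ ∧ conj du₄` are closed on the ball in the DEFINED sense `IsClosed11`
(Wirtinger derivatives `dz`, `dzbar` through `fderiv ℝ`) and real-`C²` on the ball (`Smooth11`).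

PROOF.  (1) `u_j` is holomorphic on the ball: `u₁ = T_{h_{i₁}} (a_{i₁})_s` is the Hecke translate of the `s`-coordinate
of an Albanese lift (`comp_heckeTranslate`), a finite sum of compositions `a ∘ act r` with `r` `H`-unitary
(`isUnitaryOf_of_mem_reps`: `r = γ₁ g γ₂`, `γ_i ∈ Γ′ ⊆ Γ ⊆ U(H)(𝒪)`), each holomorphic on the ball because
`act r` preserves the ball (`differentiableAt_heckeTranslate`); likewise `u₂, u₃, u₄`.  (2) Wirtinger calculus: for
`g, h` ℂ-differentiable at `z`, `∂_m (g · conj h) = ∂_m g · conj h` and `∂̄_n (g · conj h) = g · conj (∂_n h)`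
(`fderiv ℝ` of a ℂ-differentiable map is the restriction of scalars of `fderiv ℂ`, `conj = Complex.conjCLE` is ℝ-linear,
`conj (i w) = −i conj w`).  (3) The entries `ξ_{kl} = ∂_k u · conj ∂_l v`: by the several-variable regularity
(`HoloRegularity`) the partials `∂_k u`, `∂_l v` are again holomorphic on the ball, so (2) applies and gives
`∂_m ξ_{kl} = ∂_m ∂_k u · conj ∂_l v`, symmetric in `(m, k)` by `pd_pd_symm`, and `∂̄_n ξ_{kl} = ∂_k u · conj (∂_n ∂_l v)`,
symmetric in `(n, l)` by `pd_pd_symm` for `v`.  (4) L4.2′: each entry `∂_k u · conj ∂_l v` is real-`C^n` for every `n`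
(`HoloReg.contDiffOn_real_of_differentiableOn` for the holomorphic `∂_k u`, `∂_l v`; `conj` ℝ-linear; product).  No
hypothesis beyond the datum is used; `#print axioms` of both lemmas = `[propext, Classical.choice, Quot.sound]`.

Nothing here says anything about the status of the Hodge conjecture for CM abelian varieties, which is NOT proved
(HC_CM is NOT proved by anyone in this repository).
-/

set_option autoImplicit false

noncomputable section

open Matrix MeasureTheory NumberField
open scoped ComplexConjugate ComplexOrder

namespace Summit.Ventures.HodgeRepro.Tier4.Line4

open Summit.Ventures.HodgeRepro.Tier4

/-! ## 1. Wirtinger calculus for `g · conj h` with `g`, `h` holomorphic -/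

/-- `Pi.single m I = I • Pi.single m 1`. -/
theorem single_I_eq_smul (m : Fin 2) : (Pi.single m Complex.I : Fin 2 → ℂ) = Complex.I • Pi.single m 1 := by
  rw [← Pi.single_smul, smul_eq_mul, mul_one]

/-- The real derivative of `g · conj h` for `g`, `h` ℂ-differentiable at `z`: the product rule, with `conj` ℝ-linear. -/
theorem fderiv_real_mul_conj {g h : (Fin 2 → ℂ) → ℂ} {z : Fin 2 → ℂ} (hg : DifferentiableAt ℂ g z)
    (hh : DifferentiableAt ℂ h z) (v : Fin 2 → ℂ) :
    fderiv ℝ (fun w => g w * conj (h w)) z v = fderiv ℂ g z v * conj (h z) + g z * conj (fderiv ℂ h z v) := by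
  have hg' : HasFDerivAt g ((fderiv ℂ g z).restrictScalars ℝ) z := hg.hasFDerivAt.restrictScalars ℝ
  have hh' : HasFDerivAt (fun w => conj (h w))
      ((Complex.conjCLE : ℂ →L[ℝ] ℂ).comp ((fderiv ℂ h z).restrictScalars ℝ)) z :=
    Complex.conjCLE.hasFDerivAt.comp z (hh.hasFDerivAt.restrictScalars ℝ)
  have hmul : HasFDerivAt (fun w => g w * conj (h w))
      (g z • ((Complex.conjCLE : ℂ →L[ℝ] ℂ).comp ((fderiv ℂ h z).restrictScalars ℝ)) +
        conj (h z) • (fderiv ℂ g z).restrictScalars ℝ) z := hg'.mul hh'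
  rw [hmul.fderiv]
  simp only [_root_.add_apply, _root_.smul_apply, ContinuousLinearMap.comp_apply,
    ContinuousLinearMap.coe_restrictScalars', ContinuousLinearEquiv.coe_coe, Complex.conjCLE_apply, smul_eq_mul]
  ring

/-- **`∂_m (g · conj h) = ∂_m g · conj h`** for `g`, `h` holomorphic at `z` (the `∂̄`-term of `conj h` vanishes). -/
theorem dz_mul_conj {g h : (Fin 2 → ℂ) → ℂ} {z : Fin 2 → ℂ} (hg : DifferentiableAt ℂ g z)
    (hh : DifferentiableAt ℂ h z) (m : Fin 2) :
    dz m (fun w => g w * conj (h w)) z = pd m g z * conj (h z) := by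
  unfold dz pd
  rw [fderiv_real_mul_conj hg hh, fderiv_real_mul_conj hg hh, single_I_eq_smul, map_smul, map_smul]
  simp only [smul_eq_mul, map_mul, Complex.conj_I]
  ring_nf
  simp [Complex.I_sq]
  ring

/-- **`∂̄_n (g · conj h) = g · conj (∂_n h)`** for `g`, `h` holomorphic at `z` (the `∂̄`-term of `g` vanishes). -/
theorem dzbar_mul_conj {g h : (Fin 2 → ℂ) → ℂ} {z : Fin 2 → ℂ} (hg : DifferentiableAt ℂ g z)
    (hh : DifferentiableAt ℂ h z) (n : Fin 2) :
    dzbar n (fun w => g w * conj (h w)) z = g z * conj (pd n h z) := by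
  unfold dzbar pd
  rw [fderiv_real_mul_conj hg hh, fderiv_real_mul_conj hg hh, single_I_eq_smul, map_smul, map_smul]
  simp only [smul_eq_mul, map_mul, Complex.conj_I]
  ring_nf
  simp [Complex.I_sq]
  ring

/-! ## 2. Closedness and smoothness of `du ∧ conj dv` for `u`, `v` holomorphic on the ball -/

/-- **The mixed form of two holomorphic functions is closed**: for `u`, `v` holomorphic on the ball,
`ξ = du ∧ conj dv` (coefficients `ξ_{kl} = ∂_k u · conj ∂_l v`) satisfies `IsClosed11` — `∂_m ξ_{kl} = ∂_m∂_k u · conj ∂_l v`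
is symmetric in `(m, k)` and `∂̄_n ξ_{kl} = ∂_k u · conj (∂_n ∂_l v)` is symmetric in `(n, l)`, by the several-variable
regularity `HoloReg.differentiableAt_pd` / `HoloReg.pd_pd_symm`. -/
theorem isClosed11_mixedForm_grad {u v : (Fin 2 → ℂ) → ℂ} (hu : DifferentiableOn ℂ u ball)
    (hv : DifferentiableOn ℂ v ball) : IsClosed11 (fun z => mixedForm (grad u z) (grad v z)) := by
  intro z hz
  have hpu : ∀ k : Fin 2, DifferentiableAt ℂ (pd k u) z := fun k =>
    HoloReg.differentiableAt_pd isOpen_ball hu hz k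
  have hpv : ∀ k : Fin 2, DifferentiableAt ℂ (pd k v) z := fun k =>
    HoloReg.differentiableAt_pd isOpen_ball hv hz k
  have hsu : ∀ k m : Fin 2, pd m (pd k u) z = pd k (pd m u) z := fun k m =>
    HoloReg.pd_pd_symm isOpen_ball hu hz k m
  have hsv : ∀ k m : Fin 2, pd m (pd k v) z = pd k (pd m v) z := fun k m =>
    HoloReg.pd_pd_symm isOpen_ball hv hz k m
  constructor
  · intro k l m
    show dz m (fun w => pd k u w * conj (pd l v w)) z = dz k (fun w => pd m u w * conj (pd l v w)) z
    rw [dz_mul_conj (hpu k) (hpv l) m, dz_mul_conj (hpu m) (hpv l) k, hsu k m]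
  · intro k l n
    show dzbar n (fun w => pd k u w * conj (pd l v w)) z = dzbar l (fun w => pd k u w * conj (pd n v w)) z
    rw [dzbar_mul_conj (hpu k) (hpv l) n, dzbar_mul_conj (hpu k) (hpv n) l, hsv l n]


/-- **The mixed form of two holomorphic functions is real-`C^n` on the ball for every `n`** (the regularity input
of L4.2′ `mixed_smooth`): each entry `ξ_{kl} = ∂_k u · conj ∂_l v` is the product of two
functions holomorphic on the ball, hence `C^n` over `ℂ` and over `ℝ` (`HoloRegularity`). -/
theorem contDiffOn_mixedForm_grad {u v : (Fin 2 → ℂ) → ℂ} (hu : DifferentiableOn ℂ u ball)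
    (hv : DifferentiableOn ℂ v ball) (k l : Fin 2) (n : ℕ) :
    ContDiffOn ℝ n (fun z => mixedForm (grad u z) (grad v z) k l) ball := by
  have hk : ContDiffOn ℝ n (pd k u) ball :=
    HoloReg.contDiffOn_real_of_differentiableOn isOpen_ball (HoloReg.differentiableOn_pd isOpen_ball hu k) n
  have hl : ContDiffOn ℝ n (pd l v) ball :=
    HoloReg.contDiffOn_real_of_differentiableOn isOpen_ball (HoloReg.differentiableOn_pd isOpen_ball hv l) n
  have hconj : ContDiff ℝ n (fun w : ℂ => conj w) := Complex.conjCLE.contDiff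
  exact hk.mul (hconj.comp_contDiffOn hl)

/-! ## 3. The four coordinate functions of the datum are holomorphic on the ball -/

variable {F E : Type} [Field F] [NumberField F] [IsGalois ℚ F] [IsCMField F]
  [Field E] [NumberField E] [IsGalois ℚ E] [IsCMField E] (d : TargetData F E)

/-- `u₁` is the Hecke translate of the `s`-coordinate of the lift of the corner `i₁`. -/
theorem u₁_eq (h : Fin 4 → HeckeElement E) :
    u₁ d h = heckeTranslate d.τ₀ d.C (h d.i₁) (d.coord d.i₁ d.s d.hs₁) := by
  unfold u₁ TargetData.lift TargetData.coord
  exact comp_heckeTranslate _ _ _ _ _ _ _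

/-- `u₂` is the Hecke translate of the `s`-coordinate of the lift of the corner `i₂`. -/
theorem u₂_eq (h : Fin 4 → HeckeElement E) :
    u₂ d h = heckeTranslate d.τ₀ d.C (h d.i₂) (d.coord d.i₂ d.s d.hs₂) := by
  unfold u₂ TargetData.lift TargetData.coord
  exact comp_heckeTranslate _ _ _ _ _ _ _

/-- `u₃` is the Hecke translate of the `s̄`-coordinate of the lift of the corner `i₃`. -/
theorem u₃_eq (h : Fin 4 → HeckeElement E) :
    u₃ d h = heckeTranslate d.τ₀ d.C (h d.i₃) (d.coord d.i₃ (conjEmb d.s) d.hs₃) := by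
  unfold u₃ TargetData.lift TargetData.coord
  exact comp_heckeTranslate _ _ _ _ _ _ _

/-- `u₄` is the Hecke translate of the `s̄`-coordinate of the lift of the corner `i₄`. -/
theorem u₄_eq (h : Fin 4 → HeckeElement E) :
    u₄ d h = heckeTranslate d.τ₀ d.C (h d.i₄) (d.coord d.i₄ (conjEmb d.s) d.hs₄) := by
  unfold u₄ TargetData.lift TargetData.coord
  exact comp_heckeTranslate _ _ _ _ _ _ _

/-- The Hecke translate of a coordinate of a lift is holomorphic on the ball, for a Hecke element of a level `Γ′ ≤ Γ`
(every representative is `H`-unitary, so every Möbius map preserves the ball). -/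
theorem differentiableOn_heckeTranslate_coord {Γ' : Set (Matrix (Fin 3) (Fin 3) E)} (hΓ' : d.IsLevel Γ')
    {h : HeckeElement E} (hh : h.IsFor (conjE E) d.H Γ') (i : Fin 4) (σ : F →+* ℂ) (hσ : σ ∈ d.T i) :
    DifferentiableOn ℂ (heckeTranslate d.τ₀ d.C h (d.coord i σ hσ)) ball := by
  intro z hz
  exact (d.differentiableAt_heckeTranslate (d.differentiableOn_coord i σ hσ) h.terms
    (fun t ht r hr => d.isUnitaryOf_of_mem_reps hΓ'.2 hh ht hr) hz).differentiableWithinAt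

/-- `u₁` is holomorphic on the ball. -/
theorem differentiableOn_u₁ {Γ' : Set (Matrix (Fin 3) (Fin 3) E)} (hΓ' : d.IsLevel Γ') {h : Fin 4 → HeckeElement E}
    (hh : d.IsHeckeFor Γ' h) : DifferentiableOn ℂ (u₁ d h) ball := by
  rw [u₁_eq]; exact differentiableOn_heckeTranslate_coord d hΓ' (hh d.i₁) _ _ _

/-- `u₂` is holomorphic on the ball. -/
theorem differentiableOn_u₂ {Γ' : Set (Matrix (Fin 3) (Fin 3) E)} (hΓ' : d.IsLevel Γ') {h : Fin 4 → HeckeElement E}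
    (hh : d.IsHeckeFor Γ' h) : DifferentiableOn ℂ (u₂ d h) ball := by
  rw [u₂_eq]; exact differentiableOn_heckeTranslate_coord d hΓ' (hh d.i₂) _ _ _

/-- `u₃` is holomorphic on the ball. -/
theorem differentiableOn_u₃ {Γ' : Set (Matrix (Fin 3) (Fin 3) E)} (hΓ' : d.IsLevel Γ') {h : Fin 4 → HeckeElement E}
    (hh : d.IsHeckeFor Γ' h) : DifferentiableOn ℂ (u₃ d h) ball := by
  rw [u₃_eq]; exact differentiableOn_heckeTranslate_coord d hΓ' (hh d.i₃) _ _ _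

/-- `u₄` is holomorphic on the ball. -/
theorem differentiableOn_u₄ {Γ' : Set (Matrix (Fin 3) (Fin 3) E)} (hΓ' : d.IsLevel Γ') {h : Fin 4 → HeckeElement E}
    (hh : d.IsHeckeFor Γ' h) : DifferentiableOn ℂ (u₄ d h) ball := by
  rw [u₄_eq]; exact differentiableOn_heckeTranslate_coord d hΓ' (hh d.i₄) _ _ _

/-! ## 4. L4.2 and L4.2′ -/

/-- **L4.2 (DEFINED, prover-facing)** — the mixed forms are closed on the ball: `u_j` is holomorphic on the ball
(`IsAlbaneseLift`: `DifferentiableOn ℂ a_i ball`; `heckeTranslate` is a finite sum of compositions with the Möbius maps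
`actM (toBallMat τ₀ C r)`), so `ξ_{kl} = ∂_k u_j · conj (∂_l u_m)` has `∂_n ξ_{kl} = ∂_n ∂_k u_j · conj ∂_l u_m`
(symmetric in `(n,k)`) and `∂̄_n ξ_{kl} = ∂_k u_j · conj (∂_n ∂_l u_m)` (symmetric in `(n,l)`).  Statement VERBATIM from
the skeleton (v0.2 3a41b9019878f878 L320–328 = v0.3 L213 = v0.4 55f0306b6d9d5c19 L137); the several-variable regularity
is `HoloRegularity`. -/
theorem mixed_closed (Γ' : Set (Matrix (Fin 3) (Fin 3) E)) (hΓ' : d.IsLevel Γ') (h : Fin 4 → HeckeElement E)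
    (hh : d.IsHeckeFor Γ' h) :
    IsClosed11 (ξ₁₃ d h) ∧ IsClosed11 (ξ₂₄ d h) :=
  ⟨isClosed11_mixedForm_grad (differentiableOn_u₁ d hΓ' hh) (differentiableOn_u₃ d hΓ' hh),
    isClosed11_mixedForm_grad (differentiableOn_u₂ d hΓ' hh) (differentiableOn_u₄ d hΓ' hh)⟩

/-- **L4.2′ `mixed_smooth` (DEFINED, prover-facing)** — the mixed forms are `C²` on the ball (holomorphy of the `u_j`;
the same regularity step as L4.2).  Statement VERBATIM from the skeleton (v0.3 L343 = v0.4 L250). -/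
theorem mixed_smooth (Γ' : Set (Matrix (Fin 3) (Fin 3) E)) (hΓ' : d.IsLevel Γ') (h : Fin 4 → HeckeElement E)
    (hh : d.IsHeckeFor Γ' h) : Smooth11 (ξ₁₃ d h) ∧ Smooth11 (ξ₂₄ d h) :=
  ⟨fun k l => contDiffOn_mixedForm_grad (differentiableOn_u₁ d hΓ' hh) (differentiableOn_u₃ d hΓ' hh) k l 2,
    fun k l => contDiffOn_mixedForm_grad (differentiableOn_u₂ d hΓ' hh) (differentiableOn_u₄ d hΓ' hh) k l 2⟩

end Summit.Ventures.HodgeRepro.Tier4.Line4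

end
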